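import Literature.MathematicalPhysics.QuantumFieldTheory.Balaban1983to89.T4MatchingAssembly

/-!
# T⁴ programme, spine estimate NE1′ (node O3b/H2) — the SIZE HALF along a whole run: K-uniform, μ-uniform two-sided
# DOMINATION of every dressed term by its undressed twin, and what it discharges in `T4MatchingAssembly.HybridNE7`

Cell `pub-balaban-gaps` (YM blitz Y1, track G2), seat `ne1` (prover-pub-balaban-gaps-ne1-g0-0), record `HOME/ne/NE1.md`;
tree target `Summits/QuantumFields/BalabanUV/T4Continuum/Spine/NE1p/`; ADDITIVE — imports `T4MatchingAssembly` only,
modifies nothing.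

WHAT THIS IS.  The spine estimate NE1′ («dressed stability of the observable-attached terms, μ-uniform»; root of record
`NE1p.DressedRoot.DressedStabilityStrict`, `Spine/NE1p/DressedRootStrict.lean`) has a SIZE half and a FORMAT half.  The tree
holds the size half for ONE basic ℝ-step (`T4DressedR.ropRealIn_exp_sandwich`, `T4OscSandwich`) and the one-step dressing
defect (`T4DressingDefect`).  This module records the size half ALONG A WHOLE RUN and books what it buys on the consumer
side:

* §1 [abstract, values in `ℝ≥0∞`] every operation that produces the VALUE of a term of Bałaban's run from the value of its
  parent — insertion of a characteristic function (`mulOp`), the renormalisation transformation along a block averaging or any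
  positive fibre integration (`kernelOp`), and the basic ℝ-step in convention (α) with UNDRESSED insert and normalisation
  (`ratioOp`: `f ↦ ins · Q(f) / d`, [Balaban1989LargeFieldI] (0.3) p. 176 / (1.100) p. 201 as modelled in `B15.BasicStep`,
  `T4DressedR.RopIn`) — is MONOTONE and POSITIVELY HOMOGENEOUS (`IsPosHom`); such maps preserve two-sided domination
  `m·f₀ ≤ f ≤ M·f₀` (`IsPosHom.dominated`), hence so does ANY finite chain of them (`dominated_iter`): along every history the
  dressed term is dominated by the undressed term with the BIRTH constants `m = e^{−|t|B}`, `M = e^{|t|B}` (`B = sup |F|`),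
  for every number of steps — the K-UNIFORM, μ-UNIFORM (real `|t| ≤ l₀`) size statement.  Consequence [ℝ]: the TOTAL dressing
  defect along a history (the sum of `T4DressingDefect.dTerm`s in the factorisation «dressed = undressed · e^{tF} · e^{D}») is
  bounded by `2|t|B` however many ℝ-fibres the history carries (`abs_totalDefect_le`).
* §2 [the spine's vocabulary] under such a domination with ratio `c = M/m`, the bad-class WEIGHT clause and the SHELL clause of
  `T4MatchingAssembly.HybridNE7` for the DRESSED runs follow from the same clauses for the UNDRESSED runs with the weights
  multiplied by `c` (`relWeightBound_of_dominated`, `shellWeightBound_of_dominated`); a summable weight profile `< 1` has a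
  uniform bound `r < 1` (`exists_uniform_lt_one`), and `l₀` with `e^{2l₀B}·r < 1` exists (`exists_radius`), so the joint
  clause `lt_one` survives at a smaller source radius.  `hybridNE7_of_dominated`: of the five clauses of `HybridNE7` for the
  dressed runs, `weight`, `shell`, `lt_one`, `summable` are supplied from the undressed data + domination; the displayed binder
  is `core` ALONE — NE7's term-wise matching for the dressed terms, which needs the FORMAT half of NE1′ (local analytic structure
  of the dressing in the field variables), not addressed here.

WHAT THIS IS NOT.  Not NE1′: the format half ((w1) births of the observable-attached terms inside the small-field expansion,
(I4′) the transverse rate, (w5)/(w5b) regeneration under ℝ — wall of record, skeleton `t4/skeletons/NE1p-t4-ne1p-p1.md` §7) is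
untouched; 0 binders instantiated on Bałaban's densities (the run is DATA in `T4Continuum.FiniteEpsData`, its `R` a black box
beyond (0.4)); spine PROVED 0∕9 unchanged.  Rung (B)+1 bookkeeping on ONE finite four-torus — NOT infinite volume, NOT a mass
gap, NOT OS on ℝ⁴, NOT Clay.  HONEST DEPENDENCY: continuum YM on T⁴ ⇐ BetaPertH ∧ nine spine estimates (0/9 proved);
BetaPertH ⇐ (D1) ∧ (D4) ∧ CAP+tail.  Every declaration is [folklore] (order arithmetic in `ℝ≥0∞` / `ℝ`, Mathlib `lintegral`);
nothing of [Balaban1989LargeFieldI/II] is asserted — (0.3)/(1.100) are cited for the SHAPE `ins · ∫⌈(·) / ∫⌈ins` only.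
-/

noncomputable section

namespace Summit.QuantumFields.BalabanUV.T4Continuum.NE1p.DressedSizeDomination

open MeasureTheory Finset
open scoped ENNReal BigOperators
open Literature.MathematicalPhysics.QuantumFieldTheory.Balaban1983to89
open Literature.MathematicalPhysics.QuantumFieldTheory.Balaban1983to89.T4WeightBudget
open Literature.MathematicalPhysics.QuantumFieldTheory.Balaban1983to89.T4IndicatorShell
open Literature.MathematicalPhysics.QuantumFieldTheory.Balaban1983to89.T4MatchingAssembly

/-! ## §1 Monotone positively-homogeneous value maps preserve two-sided domination along any chain -/

section Abstract

variable {X Y Z : Type*}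

/-- A map of nonnegative value-functions is MONOTONE and POSITIVELY HOMOGENEOUS (finite constants). [folklore] -/
structure IsPosHom (Φ : (X → ℝ≥0∞) → (Y → ℝ≥0∞)) : Prop where
  /-- order preserving -/
  mono : ∀ ⦃f g : X → ℝ≥0∞⦄, f ≤ g → Φ f ≤ Φ g
  /-- commutes with finite constant multiples -/
  smul : ∀ (c : ℝ≥0∞), c ≠ ∞ → ∀ f : X → ℝ≥0∞, Φ (c • f) = c • Φ f

/-- TWO-SIDED DOMINATION of `f` by `f₀` with constants `m ≤ M`: `m·f₀ ≤ f ≤ M·f₀` pointwise. [folklore] -/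
def Dominated (m M : ℝ≥0∞) (f₀ f : X → ℝ≥0∞) : Prop :=
  m • f₀ ≤ f ∧ f ≤ M • f₀

/-- A monotone positively-homogeneous map preserves domination with the SAME constants. [folklore] -/
theorem IsPosHom.dominated {Φ : (X → ℝ≥0∞) → (Y → ℝ≥0∞)} (hΦ : IsPosHom Φ) {m M : ℝ≥0∞} (hm : m ≠ ∞) (hM : M ≠ ∞)
    {f₀ f : X → ℝ≥0∞} (h : Dominated m M f₀ f) : Dominated m M (Φ f₀) (Φ f) := by
  refine ⟨?_, ?_⟩
  · rw [← hΦ.smul m hm f₀]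
    exact hΦ.mono h.1
  · rw [← hΦ.smul M hM f₀]
    exact hΦ.mono h.2

/-- Composition of monotone positively-homogeneous maps is one. [folklore] -/
theorem IsPosHom.comp {Φ : (X → ℝ≥0∞) → (Y → ℝ≥0∞)} {Ψ : (Y → ℝ≥0∞) → (Z → ℝ≥0∞)} (hΨ : IsPosHom Ψ)
    (hΦ : IsPosHom Φ) : IsPosHom (Ψ ∘ Φ) where
  mono := fun _ _ h => hΨ.mono (hΦ.mono h)
  smul := fun c hc f => by
    show Ψ (Φ (c • f)) = c • Ψ (Φ f)
    rw [hΦ.smul c hc, hΨ.smul c hc]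

/-- The `n`-th iterate of a CHAIN of value maps `Φ 0, Φ 1, …` applied to `f` (one lineage of a run: the value of the
descendant term after `n` steps). [folklore] -/
def iter (Φ : ℕ → (X → ℝ≥0∞) → (X → ℝ≥0∞)) (f : X → ℝ≥0∞) : ℕ → (X → ℝ≥0∞)
  | 0 => f
  | n + 1 => Φ n (iter Φ f n)

/-- **DOMINATION ALONG A WHOLE CHAIN, SAME CONSTANTS AT EVERY STEP**: if every step is monotone positively-homogeneous and the
dressed initial value is dominated by the undressed one with constants `m ≤ M`, then so is every iterate — uniformly in the
number of steps. [folklore] -/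
theorem dominated_iter {Φ : ℕ → (X → ℝ≥0∞) → (X → ℝ≥0∞)} (hΦ : ∀ n, IsPosHom (Φ n)) {m M : ℝ≥0∞} (hm : m ≠ ∞)
    (hM : M ≠ ∞) {f₀ f : X → ℝ≥0∞} (h : Dominated m M f₀ f) : ∀ n, Dominated m M (iter Φ f₀ n) (iter Φ f n)
  | 0 => h
  | n + 1 => (hΦ n).dominated hm hM (dominated_iter hΦ hm hM h n)

/-- DOMINATION AT BIRTH: a dressing factor with values in `[m, M]` puts `f₀ · w` in the class of `f₀`. [folklore] -/
theorem dominated_mul_of_bounds {m M : ℝ≥0∞} {f₀ w : X → ℝ≥0∞} (hlo : ∀ x, m ≤ w x) (hhi : ∀ x, w x ≤ M) :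
    Dominated m M f₀ (f₀ * w) := by
  refine ⟨fun x => ?_, fun x => ?_⟩
  · show m * f₀ x ≤ f₀ x * w x
    rw [mul_comm]
    exact mul_le_mul' le_rfl (hlo x)
  · show f₀ x * w x ≤ M * f₀ x
    rw [mul_comm M]
    exact mul_le_mul' le_rfl (hhi x)

/-! ### The three kinds of value maps of the run are monotone positively-homogeneous -/

/-- INSERTION of a fixed nonnegative factor (a characteristic function of the next decomposition): `f ↦ χ · f`. [folklore] -/
def mulOp (χ : X → ℝ≥0∞) (f : X → ℝ≥0∞) : X → ℝ≥0∞ := χ * f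

/-- Insertion is monotone positively-homogeneous. [folklore] -/
theorem isPosHom_mulOp (χ : X → ℝ≥0∞) : IsPosHom (mulOp χ) where
  mono := fun _ _ h x => mul_le_mul' le_rfl (h x)
  smul := fun c _ f => funext fun x => by
    show χ x * (c * f x) = c * (χ x * f x)
    ring

/-- A POSITIVE KERNEL OPERATOR `f ↦ (y ↦ ∫⁻ κ(y, x) f(x) dμ)` — the renormalisation transformation along an averaging, or any
fibre integration of [Balaban1989LargeFieldI] §1 (product of normalised Haar measures on the integrated bond variables).
[folklore] -/
def kernelOp [MeasurableSpace X] (κ : Y → X → ℝ≥0∞) (μ : Measure X) (f : X → ℝ≥0∞) : Y → ℝ≥0∞ :=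
  fun y => ∫⁻ x, κ y x * f x ∂μ

/-- A positive kernel operator is monotone positively-homogeneous (`lintegral_mono`, `lintegral_const_mul'`). [folklore] -/
theorem isPosHom_kernelOp [MeasurableSpace X] (κ : Y → X → ℝ≥0∞) (μ : Measure X) : IsPosHom (kernelOp κ μ) where
  mono := fun _ _ h y => lintegral_mono fun x => mul_le_mul' le_rfl (h x)
  smul := fun c hc f => funext fun y => by
    show ∫⁻ x, κ y x * (c * f x) ∂μ = c * ∫⁻ x, κ y x * f x ∂μ
    rw [← lintegral_const_mul' c _ hc]
    refine lintegral_congr fun x => ?_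
    ring

/-- THE BASIC ℝ-STEP IN CONVENTION (α), as a map of the INTEGRATED piece alone: `f ↦ ins · Q(f) / d` with the UNDRESSED insert
`ins = ρ(Z″,·)`, its UNDRESSED normalisation `d = ∫⌈ρ(Z″,·)` and the fibre integration `Q` ([Balaban1989LargeFieldI] (0.3),
(1.100): shape only; `T4DressedR.RopIn`). [folklore] -/
def ratioOp (ins d : Y → ℝ≥0∞) (Q : (X → ℝ≥0∞) → (Y → ℝ≥0∞)) (f : X → ℝ≥0∞) : Y → ℝ≥0∞ :=
  fun y => ins y * Q f y / d y

/-- The ℝ-step with undressed insert and normalisation is monotone positively-homogeneous in the integrated piece. [folklore] -/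
theorem isPosHom_ratioOp (ins d : Y → ℝ≥0∞) {Q : (X → ℝ≥0∞) → (Y → ℝ≥0∞)} (hQ : IsPosHom Q) :
    IsPosHom (ratioOp ins d Q) where
  mono := fun _ _ h y => ENNReal.div_le_div_right (mul_le_mul' le_rfl (hQ.mono h y)) _
  smul := fun c hc f => funext fun y => by
    show ins y * Q (c • f) y / d y = c * (ins y * Q f y / d y)
    rw [hQ.smul c hc f, Pi.smul_apply, smul_eq_mul, div_eq_mul_inv, div_eq_mul_inv]
    ring

/-- ONE STEP OF THE RUN ON ONE LINEAGE = insertion ∘ transformation ∘ ℝ-step (any of them possibly trivial) is monotone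
positively-homogeneous. [folklore] -/
theorem isPosHom_step [MeasurableSpace X] (χ : X → ℝ≥0∞) (κ : X → X → ℝ≥0∞) (μ : Measure X) (ins d : X → ℝ≥0∞)
    {Q : (X → ℝ≥0∞) → (X → ℝ≥0∞)} (hQ : IsPosHom Q) :
    IsPosHom (ratioOp ins d Q ∘ kernelOp κ μ ∘ mulOp χ) :=
  (isPosHom_ratioOp ins d hQ).comp ((isPosHom_kernelOp κ μ).comp (isPosHom_mulOp χ))

/-- **THE RUN'S SIZE STATEMENT** (abstract): along a lineage whose every step is monotone positively-homogeneous, a dressing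
factor `w` with `m ≤ w ≤ M` at birth gives `m·(undressed) ≤ dressed ≤ M·(undressed)` after ANY number of steps. [folklore] -/
theorem dominated_run {Φ : ℕ → (X → ℝ≥0∞) → (X → ℝ≥0∞)} (hΦ : ∀ n, IsPosHom (Φ n)) {m M : ℝ≥0∞} (hm : m ≠ ∞)
    (hM : M ≠ ∞) {f₀ w : X → ℝ≥0∞} (hlo : ∀ x, m ≤ w x) (hhi : ∀ x, w x ≤ M) (n : ℕ) :
    Dominated m M (iter Φ f₀ n) (iter Φ (f₀ * w) n) :=
  dominated_iter hΦ hm hM (dominated_mul_of_bounds hlo hhi) n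

/-- Integration is a monotone positively-homogeneous map to a point: domination passes to TOTAL INTEGRALS (the numbers
`A K t τ` of the consumer are the terms' total integrals). [folklore] -/
theorem Dominated.lintegral [MeasurableSpace X] {m M : ℝ≥0∞} (hm : m ≠ ∞) (hM : M ≠ ∞) {f₀ f : X → ℝ≥0∞}
    (h : Dominated m M f₀ f) (μ : Measure X) :
    m * ∫⁻ x, f₀ x ∂μ ≤ ∫⁻ x, f x ∂μ ∧ ∫⁻ x, f x ∂μ ≤ M * ∫⁻ x, f₀ x ∂μ := by
  constructor
  · rw [← lintegral_const_mul' m _ hm]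
    exact lintegral_mono fun x => by simpa only [Pi.smul_apply, smul_eq_mul] using h.1 x
  · rw [← lintegral_const_mul' M _ hM]
    exact lintegral_mono fun x => by simpa only [Pi.smul_apply, smul_eq_mul] using h.2 x

/-- … and to their real values when the undressed integral is finite (the shape `TermDominated` of §2, one index at a time).
[folklore] -/
theorem Dominated.toReal_lintegral [MeasurableSpace X] {m M : ℝ≥0∞} (hm : m ≠ ∞) (hM : M ≠ ∞) {f₀ f : X → ℝ≥0∞}
    (h : Dominated m M f₀ f) (μ : Measure X) (hfin : ∫⁻ x, f₀ x ∂μ ≠ ∞) :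
    m.toReal * (∫⁻ x, f₀ x ∂μ).toReal ≤ (∫⁻ x, f x ∂μ).toReal ∧
      (∫⁻ x, f x ∂μ).toReal ≤ M.toReal * (∫⁻ x, f₀ x ∂μ).toReal := by
  obtain ⟨h1, h2⟩ := h.lintegral hm hM μ
  have hfin' : ∫⁻ x, f x ∂μ ≠ ∞ := ne_top_of_le_ne_top (ENNReal.mul_ne_top hM hfin) h2
  constructor
  · rw [← ENNReal.toReal_mul]
    exact ENNReal.toReal_mono hfin' h1
  · rw [← ENNReal.toReal_mul]
    exact ENNReal.toReal_mono (ENNReal.mul_ne_top hM hfin) h2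

end Abstract

/-! ### The exponential dressing and the total defect (real arithmetic) -/

section RealArith

/-- The birth constants of the exponential dressing `w = e^{tF}`, `|F| ≤ B`, on the source interval `|t| ≤ l₀`:
`e^{−l₀B} ≤ e^{tF} ≤ e^{l₀B}`. [folklore] -/
theorem exp_dressing_mem {t l₀ B F : ℝ} (ht : |t| ≤ l₀) (hF : |F| ≤ B) :
    Real.exp (-(l₀ * B)) ≤ Real.exp (t * F) ∧ Real.exp (t * F) ≤ Real.exp (l₀ * B) := by
  have hB : 0 ≤ B := (abs_nonneg F).trans hF
  have h1 : |t * F| ≤ l₀ * B := by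
    rw [abs_mul]
    exact mul_le_mul ht hF (abs_nonneg F) ((abs_nonneg t).trans ht)
  constructor
  · exact Real.exp_le_exp.mpr (by linarith [neg_abs_le (t * F)])
  · exact Real.exp_le_exp.mpr ((le_abs_self _).trans h1)

/-- **THE TOTAL DRESSING DEFECT ALONG A HISTORY IS BOUNDED BY `2·l₀·B`**: if the dressed value factorises as
`d = u · e^{tF} · e^{D}` (undressed value `u > 0`, current observable `|F| ≤ B`, `D` = the sum of the dressing defects of the
history's ℝ-fibres, `T4DressingDefect.fibreIntegral_dressed_eq`) and is dominated `e^{−l₀B}u ≤ d ≤ e^{l₀B}u`, then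
`|D| ≤ 2 l₀ B` — uniformly in the number of steps and of fibres. [folklore] -/
theorem abs_totalDefect_le {u d t F D l₀ B : ℝ} (hu : 0 < u) (ht : |t| ≤ l₀) (hF : |F| ≤ B)
    (hfac : d = u * Real.exp (t * F) * Real.exp D) (hlo : Real.exp (-(l₀ * B)) * u ≤ d)
    (hhi : d ≤ Real.exp (l₀ * B) * u) : |D| ≤ 2 * l₀ * B := by
  have h1 : |t * F| ≤ l₀ * B := by
    rw [abs_mul]
    exact mul_le_mul ht hF (abs_nonneg F) ((abs_nonneg t).trans ht)
  rw [hfac] at hlo hhi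
  have key : Real.exp (-(l₀ * B)) ≤ Real.exp (t * F + D) ∧ Real.exp (t * F + D) ≤ Real.exp (l₀ * B) := by
    rw [Real.exp_add]
    exact ⟨le_of_mul_le_mul_right (by linarith) hu, le_of_mul_le_mul_right (by linarith) hu⟩
  rw [Real.exp_le_exp, Real.exp_le_exp] at key
  rw [abs_le]
  constructor <;> linarith [key.1, key.2, neg_abs_le (t * F), le_abs_self (t * F)]

end RealArith

/-! ## §2 What the domination discharges in `HybridNE7`: the weight and shell clauses, and the joint `lt_one` at a smaller radius -/

section Transfer

variable {ι : Type*} [DecidableEq ι] {l₀ : ℝ} {T : ℕ → Finset ι} {Bad : ℕ → ℝ → Finset ι}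

/-- TERMWISE DOMINATION of a dressed family `A K t τ` by an undressed (source-free) family `A₀ K τ ≥ 0` on the source interval,
with constants `0 < m ≤ M`: the hypothesis shape §1 delivers with `m = e^{−l₀B}`, `M = e^{l₀B}`. [folklore] -/
def TermDominated (l₀ m M : ℝ) (T : ℕ → Finset ι) (A₀ : ℕ → ι → ℝ) (A : ℕ → ℝ → ι → ℝ) : Prop :=
  (∀ K, ∀ τ ∈ T K, 0 ≤ A₀ K τ) ∧
    ∀ K t, |t| ≤ l₀ → ∀ τ ∈ T K, m * A₀ K τ ≤ A K t τ ∧ A K t τ ≤ M * A₀ K τ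

omit [DecidableEq ι] in
/-- Sums over sub-families inherit the domination. [folklore] -/
theorem TermDominated.sum_le {m M : ℝ} {A₀ : ℕ → ι → ℝ} {A : ℕ → ℝ → ι → ℝ}
    (h : TermDominated l₀ m M T A₀ A) (K : ℕ) {t : ℝ} (ht : |t| ≤ l₀) {S : Finset ι} (hS : S ⊆ T K) :
    m * ∑ τ ∈ S, A₀ K τ ≤ ∑ τ ∈ S, A K t τ ∧ ∑ τ ∈ S, A K t τ ≤ M * ∑ τ ∈ S, A₀ K τ := by
  constructor
  · rw [Finset.mul_sum]
    exact Finset.sum_le_sum fun τ hτ => (h.2 K t ht τ (hS hτ)).1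
  · rw [Finset.mul_sum]
    exact Finset.sum_le_sum fun τ hτ => (h.2 K t ht τ (hS hτ)).2

omit [DecidableEq ι] in
/-- The relative-weight inequality transfers with the ratio `M/m`. [folklore] -/
theorem badWeight_of_dominated {m M : ℝ} (hm : 0 < m) (hmM : m ≤ M) {A₀ : ℕ → ι → ℝ} {A : ℕ → ℝ → ι → ℝ}
    (h : TermDominated l₀ m M T A₀ A) {W₀ : ℕ → ℝ} (hW₀ : ∀ K, 0 ≤ W₀ K) {S : ℕ → ℝ → Finset ι}
    (hS : ∀ K t, |t| ≤ l₀ → S K t ⊆ T K)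
    (h₀ : ∀ K t, |t| ≤ l₀ → ∑ τ ∈ S K t, A₀ K τ ≤ W₀ K * ∑ τ ∈ T K, A₀ K τ) (K : ℕ) (t : ℝ) (ht : |t| ≤ l₀) :
    ∑ τ ∈ S K t, A K t τ ≤ M / m * W₀ K * ∑ τ ∈ T K, A K t τ := by
  have hM : 0 ≤ M := hm.le.trans hmM
  obtain ⟨-, hS2⟩ := h.sum_le K ht (hS K t ht)
  obtain ⟨hT1, -⟩ := h.sum_le K ht (subset_refl (T K))
  have hT0 : 0 ≤ ∑ τ ∈ T K, A₀ K τ := Finset.sum_nonneg fun τ hτ => h.1 K τ hτ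
  calc ∑ τ ∈ S K t, A K t τ ≤ M * ∑ τ ∈ S K t, A₀ K τ := hS2
    _ ≤ M * (W₀ K * ∑ τ ∈ T K, A₀ K τ) := mul_le_mul_of_nonneg_left (h₀ K t ht) hM
    _ = M / m * W₀ K * (m * ∑ τ ∈ T K, A₀ K τ) := by field_simp
    _ ≤ M / m * W₀ K * ∑ τ ∈ T K, A K t τ :=
        mul_le_mul_of_nonneg_left hT1 (mul_nonneg (div_nonneg hM hm.le) (hW₀ K))

omit [DecidableEq ι] in
/-- **NE7b FOR THE DRESSED RUNS ⇐ NE7b FOR THE UNDRESSED RUNS + DOMINATION**: the bad-class relative weight clause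
`T4WeightBudget.RelWeightBound` transfers from the source-free families `A₀, B₀` to the dressed families `A, B` with the
weights multiplied by `M/m`, provided the scaled weights stay below one. [folklore] -/
theorem relWeightBound_of_dominated {m M : ℝ} (hm : 0 < m) (hmM : m ≤ M) {A₀ B₀ : ℕ → ι → ℝ}
    {A B : ℕ → ℝ → ι → ℝ} {W₀ : ℕ → ℝ}
    (h₀ : RelWeightBound l₀ T (fun K _ τ => A₀ K τ) (fun K _ τ => B₀ K τ) Bad W₀)
    (hA : TermDominated l₀ m M T A₀ A) (hB : TermDominated l₀ m M T B₀ B) (hlt : ∀ K, M / m * W₀ K < 1) :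
    RelWeightBound l₀ T A B Bad (fun K => M / m * W₀ K) where
  bad_subset := h₀.bad_subset
  nonneg := fun K => mul_nonneg (div_nonneg (hm.le.trans hmM) hm.le) (h₀.nonneg K)
  lt_one := hlt
  summable := h₀.summable.mul_left (M / m)
  bad_left := fun K t ht => badWeight_of_dominated hm hmM hA h₀.nonneg h₀.bad_subset h₀.bad_left K t ht
  bad_right := fun K t ht => badWeight_of_dominated hm hmM hB h₀.nonneg h₀.bad_subset h₀.bad_right K t ht

omit [DecidableEq ι] in
/-- **NE7c's WEIGHT HALF FOR THE DRESSED RUNS ⇐ THE UNDRESSED ONE + DOMINATION** of terms AND of shell parts (shell parts are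
produced along the same lineages), with `sh ≤ term` for the dressed families displayed (a shell part is a part).
[folklore] -/
theorem shellWeightBound_of_dominated {m M : ℝ} (hm : 0 < m) (hmM : m ≤ M) {A₀ B₀ shA₀ shB₀ : ℕ → ι → ℝ}
    {A B shA shB : ℕ → ℝ → ι → ℝ} {Wsh₀ : ℕ → ℝ}
    (h₀ : ShellWeightBound l₀ T (fun K _ τ => A₀ K τ) (fun K _ τ => B₀ K τ) (fun K _ τ => shA₀ K τ)
      (fun K _ τ => shB₀ K τ) Wsh₀)
    (hA : TermDominated l₀ m M T A₀ A) (hB : TermDominated l₀ m M T B₀ B)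
    (hshA : TermDominated l₀ m M T shA₀ shA) (hshB : TermDominated l₀ m M T shB₀ shB)
    (hleA : ∀ K t, |t| ≤ l₀ → ∀ τ ∈ T K, shA K t τ ≤ A K t τ)
    (hleB : ∀ K t, |t| ≤ l₀ → ∀ τ ∈ T K, shB K t τ ≤ B K t τ) :
    ShellWeightBound l₀ T A B shA shB (fun K => M / m * Wsh₀ K) where
  nonneg := fun K => mul_nonneg (div_nonneg (hm.le.trans hmM) hm.le) (h₀.nonneg K)
  summable := h₀.summable.mul_left (M / m)
  sh_nonneg_left := fun K t ht τ hτ =>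
    (mul_nonneg hm.le (hshA.1 K τ hτ)).trans (hshA.2 K t ht τ hτ).1
  sh_le_left := hleA
  sh_nonneg_right := fun K t ht τ hτ =>
    (mul_nonneg hm.le (hshB.1 K τ hτ)).trans (hshB.2 K t ht τ hτ).1
  sh_le_right := hleB
  left := fun K t ht => by
    have hM : 0 ≤ M := hm.le.trans hmM
    obtain ⟨-, hS2⟩ := hshA.sum_le K ht (subset_refl (T K))
    obtain ⟨hT1, -⟩ := hA.sum_le K ht (subset_refl (T K))
    calc ∑ τ ∈ T K, shA K t τ ≤ M * ∑ τ ∈ T K, shA₀ K τ := hS2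
      _ ≤ M * (Wsh₀ K * ∑ τ ∈ T K, A₀ K τ) := mul_le_mul_of_nonneg_left (h₀.left K t ht) hM
      _ = M / m * Wsh₀ K * (m * ∑ τ ∈ T K, A₀ K τ) := by field_simp
      _ ≤ M / m * Wsh₀ K * ∑ τ ∈ T K, A K t τ :=
          mul_le_mul_of_nonneg_left hT1 (mul_nonneg (div_nonneg hM hm.le) (h₀.nonneg K))
  right := fun K t ht => by
    have hM : 0 ≤ M := hm.le.trans hmM
    obtain ⟨-, hS2⟩ := hshB.sum_le K ht (subset_refl (T K))
    obtain ⟨hT1, -⟩ := hB.sum_le K ht (subset_refl (T K))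
    calc ∑ τ ∈ T K, shB K t τ ≤ M * ∑ τ ∈ T K, shB₀ K τ := hS2
      _ ≤ M * (Wsh₀ K * ∑ τ ∈ T K, B₀ K τ) := mul_le_mul_of_nonneg_left (h₀.right K t ht) hM
      _ = M / m * Wsh₀ K * (m * ∑ τ ∈ T K, B₀ K τ) := by field_simp
      _ ≤ M / m * Wsh₀ K * ∑ τ ∈ T K, B K t τ :=
          mul_le_mul_of_nonneg_left hT1 (mul_nonneg (div_nonneg hM hm.le) (h₀.nonneg K))

/-- A summable profile of numbers `< 1` is bounded by one number `r < 1` (it tends to `0`; finitely many exceptions).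
[folklore] -/
theorem exists_uniform_lt_one {W : ℕ → ℝ} (hs : Summable W) (hlt : ∀ K, W K < 1) : ∃ r < 1, ∀ K, W K ≤ r := by
  have h0 : Filter.Tendsto W Filter.atTop (nhds 0) := hs.tendsto_atTop_zero
  have hev : ∀ᶠ K in Filter.atTop, W K ≤ 1 / 2 :=
    (h0.eventually (ge_mem_nhds (by norm_num : (0 : ℝ) < 1 / 2)))
  obtain ⟨N, hN⟩ := Filter.eventually_atTop.mp hev
  -- the finitely many `K < N` have a maximum `< 1`
  let s : Finset ℝ := (Finset.range N).image W
  by_cases hne : s.Nonempty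
  · have hmax : s.max' hne < 1 := by
      obtain ⟨K, -, hK⟩ := Finset.mem_image.mp (s.max'_mem hne)
      rw [← hK]; exact hlt K
    refine ⟨max (s.max' hne) (1 / 2), max_lt hmax (by norm_num), fun K => ?_⟩
    by_cases hK : K < N
    · exact (s.le_max' (W K) (Finset.mem_image.mpr ⟨K, Finset.mem_range.mpr hK, rfl⟩)).trans (le_max_left _ _)
    · exact (hN K (not_lt.mp hK)).trans (le_max_right _ _)
  · refine ⟨1 / 2, by norm_num, fun K => hN K ?_⟩
    by_contra hK
    exact hne ⟨W K, Finset.mem_image.mpr ⟨K, Finset.mem_range.mpr (not_le.mp hK), rfl⟩⟩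

/-- THE SOURCE RADIUS: for `r < 1` and any `B` there is `l₀ > 0` with `e^{2 l₀ B} · r < 1` (the room the constant
`M/m = e^{2l₀B}` needs in `lt_one`). [folklore] -/
theorem exists_radius {r : ℝ} (hr : r < 1) (B : ℝ) : ∃ l₀ : ℝ, 0 < l₀ ∧ Real.exp (2 * l₀ * B) * r < 1 := by
  by_cases hr0 : r ≤ 0
  · exact ⟨1, one_pos, by nlinarith [Real.exp_pos (2 * 1 * B)]⟩
  have hr0' : 0 < r := lt_of_not_ge hr0
  -- continuity of `l ↦ e^{2lB}·r` at `0`, where its value is `r < 1`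
  have hcont : ContinuousAt (fun l : ℝ => Real.exp (2 * l * B) * r) 0 := by fun_prop
  have hval : (fun l : ℝ => Real.exp (2 * l * B) * r) 0 < 1 := by simpa using hr
  have hev : ∀ᶠ l in nhds (0 : ℝ), Real.exp (2 * l * B) * r < 1 := hcont.eventually (gt_mem_nhds hval)
  obtain ⟨ε, hε, hball⟩ := Metric.eventually_nhds_iff.mp hev
  refine ⟨ε / 2, by positivity, hball ?_⟩
  rw [Real.dist_eq, sub_zero, abs_of_pos (by positivity)]
  linarith

/-- **OF `HybridNE7`'s FIVE CLAUSES THE DRESSING IS CHARGED TO `core` ALONE.**  Given the hybrid-NE7 datum of the UNDRESSED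
runs (source-free families), termwise domination of the dressed families and of their shell parts with ratio `M/m`, the
displayed `sh ≤ term` for the dressed families, the room `(M/m)·(W₀ K + Wsh₀ K) < 1`, and — DISPLAYED, the located remainder
— NE7's TERM-WISE CORE MATCHING FOR THE DRESSED TERMS, the dressed runs carry a hybrid-NE7 datum (weights scaled by `M/m`,
same bad classes, same remainders `δ`). [folklore] -/
theorem hybridNE7_of_dominated {vol m M : ℝ} (hm : 0 < m) (hmM : m ≤ M) {A₀ B₀ shA₀ shB₀ : ℕ → ι → ℝ}
    {A B shA shB : ℕ → ℝ → ι → ℝ} {W₀ Wsh₀ δ : ℕ → ℝ}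
    (h₀ : HybridNE7 l₀ vol T (fun K _ τ => A₀ K τ) (fun K _ τ => B₀ K τ) Bad W₀ (fun K _ τ => shA₀ K τ)
      (fun K _ τ => shB₀ K τ) Wsh₀ δ)
    (hA : TermDominated l₀ m M T A₀ A) (hB : TermDominated l₀ m M T B₀ B)
    (hshA : TermDominated l₀ m M T shA₀ shA) (hshB : TermDominated l₀ m M T shB₀ shB)
    (hleA : ∀ K t, |t| ≤ l₀ → ∀ τ ∈ T K, shA K t τ ≤ A K t τ)
    (hleB : ∀ K t, |t| ≤ l₀ → ∀ τ ∈ T K, shB K t τ ≤ B K t τ)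
    (hroom : ∀ K, M / m * (W₀ K + Wsh₀ K) < 1)
    (hcore : ∀ K : ℕ, ∃ c : ℝ, ∀ t : ℝ, |t| ≤ l₀ → ∀ τ ∈ T K \ Bad K t,
      Real.exp (c - vol * δ K) * (A K t τ - shA K t τ) ≤ B K t τ - shB K t τ ∧
        B K t τ - shB K t τ ≤ Real.exp (c + vol * δ K) * (A K t τ - shA K t τ)) :
    HybridNE7 l₀ vol T A B Bad (fun K => M / m * W₀ K) shA shB (fun K => M / m * Wsh₀ K) δ where
  weight := relWeightBound_of_dominated hm hmM h₀.weight hA hB fun K => by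
    have := hroom K
    have hWsh : 0 ≤ M / m * Wsh₀ K := mul_nonneg (div_nonneg (hm.le.trans hmM) hm.le) (h₀.shell.nonneg K)
    nlinarith
  shell := shellWeightBound_of_dominated hm hmM h₀.shell hA hB hshA hshB hleA hleB
  lt_one := fun K => by have := hroom K; nlinarith
  summable := h₀.summable
  core := hcore

end Transfer

end Summit.QuantumFields.BalabanUV.T4Continuum.NE1p.DressedSizeDomination

end
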